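import Literature.MathematicalPhysics.QuantumFieldTheory.Balaban1983to89.B9Thm37TransposedCommutatorMajorant

/-!
# `Balaban1983to89.B9Thm37GpTorusRegularFinal` — T. Bałaban, *Propagators for lattice gauge theories in a background field*, Commun. Math. Phys.
# **99** (1985) 389–434 [Balaban1985BackgroundPropagators], Theorem 3.7 (3.87)–(3.90) pp. 409–410 ⇒ ALL FOUR INEQUALITIES (3.42) OF THEOREM 3.1 FOR
# `G′(U)`: the algebraic inputs `G′Δ′_a = 1`, (3.88) and its transposed reading INSTANTIATED at def-Y's genuine `Δ′_a(U)` from the LOCAL-INVERSE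
# properties of the cube letters — the consumer-facing form of module M5.5

statement-level skeleton of published theorems with citation tags; proofs where landed; nothing here is a claim about the Yang–Mills mass gap

PDF held: `paper:balaban1985-cmp99-background-propagators` (journal page = PDF page + 388); pp. 397, 408–410 read from the held text layer;
[4] = [Balaban1984PropagatorsII] pp. 232, 234.

THE PRINT.  p. 408: *«We have Σ_{□∈𝒟} h²_□ = 1»*; p. 409 (3.87) *«G′₀ = Σ_{□∈𝒟} h_□G′_□h_□»*, (3.88) *«Δ′_aG′₀ = I − Σ_□K(h_□)G′_□h_□ = I − R′»*, (3.90)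
*«G′ = G′₀(I − R′)⁻¹»*, Theorem 3.7 *«For M sufficiently large»*; p. 410: *«This theorem follows simply from Corollary 3.6 holding for all G′_□, □ ∈ 𝒟,
from the bound (3.89) and Lemma 2.1 … Theorem 3.7 implies that all the inequalities (3.42)–(3.47) hold for G′, thus we have completed the proof of
Theorem 3.1»*; Thm 3.1 (3.42) p. 397.

WHY THIS FILE (cell context: G-B9-LETTERS, module M5.5 FILE 6 = the consumer-facing wrapper; consumer = M5.9 `lettersAt_of_regular`).
`B9Thm37TransposedCommutatorMajorant.eBlock_kernelFamilySInv_Gp_of_cubeCover'` displays three ALGEBRAIC identities in `End_ℝ` — `G′·Δ = 1` (`hinv`),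
`Δ·(Σ_□h_□O_□h_□) = 1 − Σ_□R_□` (`h388`) and `(Σ_□h_□O_□h_□)·Δ = 1 − Σ_□V_□` (`h388T`) — for abstract `Δ`, `R_□`, `V_□`.  Here they are INSTANTIATED:
`Δ := Δ′_a(U₁)` (def-Y's `deltaPrimeAY`), `R_□ := K(h_□)O_□h_□`, `V_□ := −h_□O_□K(h_□)`, and DERIVED from `G′(U₁)·Δ′_a(U₁) = 1` in `End_ℂ` (`hinvC` — M5.3:
`G′ = (Δ′_a)⁻¹`) and the two LOCAL-INVERSE properties of the cube letters `h_□Δ′_aO_□h_□ = h_□²`, `h_□O_□Δ′_ah_□ = h_□²` (`hloc`, `hlocT` — print: `G′_□` is the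
propagator of the cube sequence `{Ω_n(□)}`, `Ω₀(□) ⊃ □̃ ⊃ supp h_□`, p. 408; the content of M5.1∕M5.2) through p38's `B9Thm37CubeCoverCommutators.eq388_hT`
and FILE 5a's `B9Thm37TransposedCommutator.eq388T_hT'` (`End_ℂ → End_ℝ` by `restrictScalars`, pointwise).  ★★ `eBlock_kernelFamilySInv_Gp_of_localInverse`:
the (3.42) block `EBlock (kernelFamilySInv i B cfg G′ par) (M₂(Σ‖b_j‖)·Bc) ((1−2α)δ₀) U₁` of the reading of `G′(U₁)` over the invariant class, displayed
inputs = the cube letters' Cor-3.6 blocks over the class (`hE`), `hinvC`, `hloc`, `hlocT`, the bond variables and averaging transporters bi-contractive at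
`U₁`, `η = |c_f|⁻¹`, the corner-free section `ιB`, the basis `b` with `M₂`, the neighbourhood count `m_N` ([4] (2.61)), [4] Lemma 2.1 at exponent `α`,
and the two located smallness conditions («M sufficiently large»).

WHAT IS PROVED (all `theorem`s, no `sorry`).  `restrict_mul_eq_one_of_mul_eq_one`, `h388_restrict_of_loc`, `restrict_R_apply`, `restrict_Vt_apply`, `h388T_restrict_of_locT`,
★★ `eBlock_kernelFamilySInv_Gp_of_localInverse`.
-/

noncomputable section

namespace Literature.MathematicalPhysics.QuantumFieldTheory.Balaban1983to89.B9Thm37GpTorusRegularFinal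

open Node00 B9CubeLettersInvReadings
open B9Thm37GpTorusRegularCubes (SQT)
open B9Thm37TransposedCommutator (eq388T_hT')
open B9Thm37TransposedCommutatorMajorant (eBlock_kernelFamilySInv_Gp_of_cubeCover')
open B9Thm37CubeCoverCommutators (cutMulY cutMulY_apply hTY KhY eq388_hT)
open B9Thm37CubeCoverCommutatorSizes (side_conditions four_le_P')
open B9Thm37CommutatorBound389 (theta389)
open B6Geom246MultiLevelBox (bset blkOf)
open B6Cover236MultiLevelBlocks (cubes)
open B6Partition118KLevelFineSizes (C1F)
open B6Partition118KLevelFineSecond (C2F)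
open B6Partition118KLevelTorusBinders (sLipT)
open B6Ineq2142KLevelV1 (β)
open B6KLevelCensusIndexV1 (KIdx)
open B6RandomWalk (Ineq261 Ineq263)
open B9Thm34Ext (toB6)
open B9FromB6 (EBlock)
open B9GeoNormsKLevelV1 (geo9K)
open scoped Matrix

variable {d ℓ : ℕ} {hd : 1 ≤ d + 1} {hL : Odd (ℓ + 1) ∧ 1 < ℓ + 1} {b₀ b₁ : ℝ}
variable {𝔸 : Type} [NormedRing 𝔸] [NormedAlgebra ℂ 𝔸] [CompleteSpace 𝔸]
variable {ι : Type} [Fintype ι] [DecidableEq ι]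
variable (i : KIdx d ℓ hd hL b₀ b₁) (b : Module.Basis ι ℝ 𝔸)
variable [Fintype (geo9K i).Site] [DecidableEq (geo9K i).Site] {Rr : ℝ} {Hp : Prop}
variable {B : B9.Backgrounds} (cfg : B.Cfg → CfgY 𝔸 i) (parS : SiteParY 𝔸 i) {U₁ : B.Cfg}

omit [CompleteSpace 𝔸] [Fintype ι] [DecidableEq ι] [Fintype (geo9K i).Site] [DecidableEq (geo9K i).Site] in
/-- `End_ℂ → End_ℝ`: a product equal to one stays so after restricting scalars. [cite: Balaban1985BackgroundPropagators, (3.90) p.409, bookkeeping] -/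
theorem restrict_mul_eq_one_of_mul_eq_one {G Δ : Module.End ℂ (SiteY i → 𝔸)} (h : G * Δ = 1) :
    G.restrictScalars ℝ * Δ.restrictScalars ℝ = 1 :=
  LinearMap.ext fun Λ => LinearMap.congr_fun h Λ

omit [Fintype ι] [DecidableEq ι] [Fintype (geo9K i).Site] [DecidableEq (geo9K i).Site] in
/-- **(3.88) AT def-Y's `Δ′_a(U)` IN `End_ℝ`**: under the local-inverse property `h_□Δ′_a(U)O_□h_□ = h_□²` for every cube,
`Δ′_a(U)·(Σ_□h_□O_□h_□) = 1 − Σ_□K(h_□)O_□h_□` after restricting scalars (p38's `eq388_hT`, pointwise). [cite: Balaban1985BackgroundPropagators, (3.87)–(3.88) p.409] -/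
theorem h388_restrict_of_loc (U : CfgY 𝔸 i) (Oc : ↥(cubes i.D.toDomains) → SiteOpY 𝔸 i)
    (hloc : ∀ c, cutMulY (hTY i c) * deltaPrimeAY i parS U * Oc c U * cutMulY (hTY i c) = cutMulY (hTY i c) * cutMulY (hTY i c)) :
    (deltaPrimeAY i parS U).restrictScalars ℝ *
        (∑ c, (cutMulY (𝔸 := 𝔸) (hTY i c)).restrictScalars ℝ * (Oc c U).restrictScalars ℝ * (cutMulY (𝔸 := 𝔸) (hTY i c)).restrictScalars ℝ)
      = 1 - ∑ c, (KhY i parS (hTY i c) U * Oc c U * cutMulY (hTY i c)).restrictScalars ℝ := by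
  refine LinearMap.ext fun Λ => ?_
  have h := LinearMap.congr_fun (eq388_hT i parS U (fun c => Oc c U) hloc) Λ
  rw [Module.End.mul_apply, LinearMap.sum_apply, LinearMap.sub_apply, LinearMap.sum_apply, Module.End.one_apply] at h ⊢
  exact h

omit [Fintype ι] [DecidableEq ι] [Fintype (geo9K i).Site] [DecidableEq (geo9K i).Site] in
/-- the commutator term `R_□ = K(h_□)O_□h_□` restricted to real scalars, applied. [cite: Balaban1985BackgroundPropagators, (3.88) p.409, bookkeeping] -/
theorem restrict_R_apply (U : CfgY 𝔸 i) (Oc : ↥(cubes i.D.toDomains) → SiteOpY 𝔸 i) (c : ↥(cubes i.D.toDomains)) (Λ : SiteY i → 𝔸) :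
    (KhY i parS (hTY i c) U * Oc c U * cutMulY (hTY i c)).restrictScalars ℝ Λ = KhY i parS (hTY i c) U (Oc c U (cutMulY (hTY i c) Λ)) := rfl

omit [Fintype ι] [DecidableEq ι] [Fintype (geo9K i).Site] [DecidableEq (geo9K i).Site] in
/-- the transposed commutator term `V_□ = −h_□O_□K(h_□)` restricted to real scalars, evaluated. [cite: Balaban1985BackgroundPropagators, (3.88) p.409, bookkeeping] -/
theorem restrict_Vt_apply (U : CfgY 𝔸 i) (Oc : ↥(cubes i.D.toDomains) → SiteOpY 𝔸 i) (c : ↥(cubes i.D.toDomains)) (Λ : SiteY i → 𝔸)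
    (z : SiteY i) :
    (-(cutMulY (hTY i c) * Oc c U * KhY i parS (hTY i c) U)).restrictScalars ℝ Λ z
      = -(cutMulY (hTY i c) (Oc c U (KhY i parS (hTY i c) U Λ)) z) := rfl

omit [Fintype ι] [DecidableEq ι] [Fintype (geo9K i).Site] [DecidableEq (geo9K i).Site] in
/-- **THE TRANSPOSED (3.88) AT def-Y's `Δ′_a(U)` IN `End_ℝ`**: under the right local-inverse property `h_□O_□Δ′_a(U)h_□ = h_□²`,
`(Σ_□h_□O_□h_□)·Δ′_a(U) = 1 − Σ_□(−h_□O_□K(h_□))` after restricting scalars (FILE 5a's `eq388T_hT'`, pointwise). [cite: Balaban1985BackgroundPropagators, (3.87)–(3.88) p.409] -/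
theorem h388T_restrict_of_locT (U : CfgY 𝔸 i) (Oc : ↥(cubes i.D.toDomains) → SiteOpY 𝔸 i)
    (hlocT : ∀ c, cutMulY (hTY i c) * Oc c U * deltaPrimeAY i parS U * cutMulY (hTY i c) = cutMulY (hTY i c) * cutMulY (hTY i c)) :
    (∑ c, (cutMulY (𝔸 := 𝔸) (hTY i c)).restrictScalars ℝ * (Oc c U).restrictScalars ℝ * (cutMulY (𝔸 := 𝔸) (hTY i c)).restrictScalars ℝ) *
        (deltaPrimeAY i parS U).restrictScalars ℝ
      = 1 - ∑ c, (-(cutMulY (hTY i c) * Oc c U * KhY i parS (hTY i c) U)).restrictScalars ℝ := by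
  refine LinearMap.ext fun Λ => ?_
  have h := LinearMap.congr_fun (eq388T_hT' i parS U (fun c => Oc c U) hlocT) Λ
  rw [Module.End.mul_apply, LinearMap.sum_apply, LinearMap.sub_apply, LinearMap.sum_apply, Module.End.one_apply] at h ⊢
  exact h

set_option maxHeartbeats 1600000 in
/-- ★★ **THEOREM 3.7 ⇒ ALL FOUR INEQUALITIES (3.42) FOR `G′(U)` — THE CONSUMER-FACING FORM OF MODULE M5.5.**  For the propagator letter `G′` with
`G′(U₁)·Δ′_a(U₁) = 1` (`hinvC`), cube letters `O_□` satisfying Cor. 3.6 at `U₁` as (3.42) blocks over the invariant class (`hE`) and the two local-inverse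
properties at the cut-offs of record (`hloc`, `hlocT`), bi-contractive bond variables and averaging transporters at `U₁`, `η = |c_f|⁻¹`, a corner-free section
`ιB`, a real basis `b` with coordinate bound `M₂`, at most `m_N` index bonds within `1` of a bond, [4] Lemma 2.1 at exponent `α` for the member and the two
located smallness conditions: the reading of `G′(U₁)` over the invariant class satisfies (3.42)₁₋₄ as the block
`EBlock (kernelFamilySInv i B cfg G′ par) (M₂(Σ‖b_j‖)·Bc) ((1−2α)δ₀) U₁`, `Bc` as in FILE 5b (p. 403 «of course with different constants», p. 410 «a decay
rate arbitrarily close»). [cite: Balaban1985BackgroundPropagators, Thm 3.7 (3.87)–(3.90) pp.409–410 ⇒ Thm 3.1 (3.42) p.397, Cor. 3.6 p.408; Balaban1984PropagatorsII, Prop 2.2 (2.65)–(2.67) p.234, Lemma 2.1 (2.61) p.234] -/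
theorem eBlock_kernelFamilySInv_Gp_of_localInverse (ιB : BlkY i → IBondY i) (hι : ∀ s, β i.hN i.D i.hk (ιB s) = s)
    {M₂ : ℝ} (hM₂ : 0 ≤ M₂) (hrepr : ∀ (v : 𝔸) (j : ι), |b.repr v j| ≤ M₂ * ‖v‖) (hη : etaS i = |i.cf|⁻¹)
    (Gp : SiteOpY 𝔸 i) (Oc : ↥(cubes i.D.toDomains) → SiteOpY 𝔸 i)
    (hinvC : Gp (cfg U₁) * deltaPrimeAY i parS (cfg U₁) = 1)
    (hloc : ∀ c, cutMulY (hTY i c) * deltaPrimeAY i parS (cfg U₁) * Oc c (cfg U₁) * cutMulY (hTY i c) = cutMulY (hTY i c) * cutMulY (hTY i c))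
    (hlocT : ∀ c, cutMulY (hTY i c) * Oc c (cfg U₁) * deltaPrimeAY i parS (cfg U₁) * cutMulY (hTY i c) = cutMulY (hTY i c) * cutMulY (hTY i c))
    {B₀ δ₀ : ℝ} (hB₀ : 0 ≤ B₀) (hδ₀ : 0 ≤ δ₀) (hE : ∀ c, EBlock (kernelFamilySInv i B cfg (Oc c) parS) B₀ δ₀ U₁)
    (hVb : ∀ (μ : Fin (d + 1)) (x : SiteY i), ‖(UboxY i (cfg U₁) μ x : 𝔸)‖ ≤ 1 ∧ ‖(((UboxY i (cfg U₁) μ x)⁻¹ : 𝔸ˣ) : 𝔸)‖ ≤ 1)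
    (hTr : ∀ z w : SiteY i, ‖(avgTrY i parS (cfg U₁) z w : 𝔸)‖ ≤ 1 ∧ ‖(((avgTrY i parS (cfg U₁) z w)⁻¹ : 𝔸ˣ) : 𝔸)‖ ≤ 1)
    (Tn : IBondY i → Finset (IBondY i)) (hTn : ∀ a y' : IBondY i, (geo9K i).dist a y' ≤ 1 → a ∈ Tn y')
    {mN : ℕ} (hnbr : ∀ y' : IBondY i, (Tn y').card ≤ mN)
    (d' : ℕ) {α : ℝ} (hαδ : 0 ≤ α * δ₀) (hαδ2 : 0 ≤ (1 - 2 * α) * δ₀)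
    (h261 : Ineq261 d' (toB6 (geo9K i) Rr Hp) δ₀ α) (h263 : Ineq263 d' (toB6 (geo9K i) Rr Hp) δ₀ α)
    (hsmall : (3 * 5 ^ (d + 1)) * (M₂ * (∑ j, ‖b j‖) * (theta389 d ℓ B₀ δ₀ / (((ℓ : ℝ) + 1) * i.Mh))) * B6.c1 d' δ₀ α < 1)
    (hsmallV : (3 * 5 ^ (d + 1)) * (M₂ * (∑ j, ‖b j‖) *
      ((B₀ * (((d : ℝ) + 1) * ((1 + (mN : ℝ) * Real.exp δ₀) * (5 / 8 * C1F d ℓ / i.Mh)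
          + (mN : ℝ) * Real.exp δ₀ * ((5 / 8) ^ 2 * C2F d ℓ / (i.Mh : ℝ) ^ 2))
        + ((ℓ : ℝ) + 1) ^ 4 * (sLipT d ℓ / (((ℓ : ℝ) + 1) * i.Mh)))) * ((ℓ : ℝ) + 1) ^ 4)) * B6.c1 d' δ₀ α < 1) :
    EBlock (kernelFamilySInv i B cfg Gp parS)
      (M₂ * (∑ j, ‖b j‖) *
        ((3 * 5 ^ (d + 1)) * (M₂ * (∑ j, ‖b j‖) * B₀) * B6.c1 d' δ₀ α *
            (1 - (3 * 5 ^ (d + 1)) * (M₂ * (∑ j, ‖b j‖) * (theta389 d ℓ B₀ δ₀ / (((ℓ : ℝ) + 1) * i.Mh))) * B6.c1 d' δ₀ α)⁻¹ +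
          (3 * 5 ^ (d + 1)) * (M₂ * (∑ j, ‖b j‖) * (B₀ * (1 + 5 / 8 * C1F d ℓ / i.Mh))) * B6.c1 d' δ₀ α *
            (1 - (3 * 5 ^ (d + 1)) * (M₂ * (∑ j, ‖b j‖) * (theta389 d ℓ B₀ δ₀ / (((ℓ : ℝ) + 1) * i.Mh))) * B6.c1 d' δ₀ α)⁻¹ +
          (3 * 5 ^ (d + 1)) * (M₂ * (∑ j, ‖b j‖) * (B₀ * (1 + (mN : ℝ) * Real.exp δ₀ * (5 / 8 * C1F d ℓ / i.Mh)))) * B6.c1 d' δ₀ α *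
            (1 - (3 * 5 ^ (d + 1)) * (M₂ * (∑ j, ‖b j‖) *
              ((B₀ * (((d : ℝ) + 1) * ((1 + (mN : ℝ) * Real.exp δ₀) * (5 / 8 * C1F d ℓ / i.Mh)
                  + (mN : ℝ) * Real.exp δ₀ * ((5 / 8) ^ 2 * C2F d ℓ / (i.Mh : ℝ) ^ 2))
                + ((ℓ : ℝ) + 1) ^ 4 * (sLipT d ℓ / (((ℓ : ℝ) + 1) * i.Mh)))) * ((ℓ : ℝ) + 1) ^ 4)) * B6.c1 d' δ₀ α)⁻¹ +
          (3 * 5 ^ (d + 1)) * (M₂ * (∑ j, ‖b j‖) * (B₀ + theta389 d ℓ B₀ δ₀ / (((ℓ : ℝ) + 1) * i.Mh))) * B6.c1 d' δ₀ α *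
            (1 - (3 * 5 ^ (d + 1)) * (M₂ * (∑ j, ‖b j‖) * (theta389 d ℓ B₀ δ₀ / (((ℓ : ℝ) + 1) * i.Mh))) * B6.c1 d' δ₀ α)⁻¹))
      ((1 - 2 * α) * δ₀) U₁ := by
  have hinv := restrict_mul_eq_one_of_mul_eq_one i hinvC
  have h388 := h388_restrict_of_loc i parS (cfg U₁) Oc hloc
  have h388T := h388T_restrict_of_locT i parS (cfg U₁) Oc hlocT
  have h := eBlock_kernelFamilySInv_Gp_of_cubeCover' i b cfg parS (Rr := Rr) (Hp := Hp) ιB hι hM₂ hrepr hη Gp Oc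
    (fun c => (KhY i parS (hTY i c) (cfg U₁) * Oc c (cfg U₁) * cutMulY (hTY i c)).restrictScalars ℝ)
    (fun c => (-(cutMulY (hTY i c) * Oc c (cfg U₁) * KhY i parS (hTY i c) (cfg U₁))).restrictScalars ℝ)
    (restrict_R_apply i parS (cfg U₁) Oc) (restrict_Vt_apply i parS (cfg U₁) Oc) hinv h388 h388T
    hB₀ hδ₀ hE hVb hTr Tn hTn hnbr d' hαδ hαδ2 h261 h263 hsmall hsmallV
  exact h

end Literature.MathematicalPhysics.QuantumFieldTheory.Balaban1983to89.B9Thm37GpTorusRegularFinal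

end
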